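import Summits.CriticalPhenomena.Ising3D.Control2DBoxCells
import Summits.CriticalPhenomena.Ising3D.Control2DL11BoxEData1
import Summits.CriticalPhenomena.Ising3D.Control2DL11BoxEData2
import Summits.CriticalPhenomena.Ising3D.Control2DL11BoxEData3
import Summits.CriticalPhenomena.Ising3D.Control2DL11BoxEData4
import Summits.CriticalPhenomena.Ising3D.Control2DL11BoxEData5
import Summits.CriticalPhenomena.Ising3D.Control2DL11BoxEData6
import Summits.CriticalPhenomena.Ising3D.Control2DL11BoxEData7
import Summits.CriticalPhenomena.Ising3D.Control2DL11BoxEData8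
import Mathlib.Tactic.IntervalCases
import Mathlib.Tactic.Linarith
import Mathlib.Tactic.NormNum
import HarnessLib

/-!
# Kernel replay of the RB-2 certificate `j110151_functional_deriv2d_L11_E032_sig1o8_box0.55-0.7.json` (Λ = 11, E₀ = 32): Δ_ε ∉ [11/20, 7/10] at Δ_σ = 1/8 under A2D′: the cells as ONE theorem
(cell `pub-ising3x`, seat controls-1 gen 16; KERNEL PATH for the 2D γ-certificates, Λ = 11 — CONTROL-ONLY)

HONEST FRAMING: lottery ticket; floor = tightest certified 3D Ising CFT bounds; no exact-solution
claim without a proof. CONTROL-ONLY (`d = 2`, `Δ_σ = 1/8`; axiom set A2D′).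

`cells_boxE`: every cell obligation of the certificate ((E) on the ε box, (C′) scalars on [2, 32), the stress-tensor point (T), spin 2 on [3, 32), even spins 4…30 on [ℓ, 32)), in the witness form `∃ N ≥ E₀` with the spin's own truncation
order, from the kernel-decided Bernstein leaves of `Control2DL11BoxEData*` via `cell_nonneg_of_bernCheck`. No facts, standard axioms only.
-/

namespace Summit.CriticalPhenomena.Ising3D.Control2D

open Finset Set
open Literature.MathematicalPhysics.QuantumFieldTheory.ConformalBootstrap3D

set_option maxHeartbeats 0 in
/-- **The cells of the certificate** (Δ_ε ∉ [11/20, 7/10] at Δ_σ = 1/8 under A2D′; `E₀ = 32`; truncation `N = Nd + 1` per spin: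
ℓ=0: 48, ℓ=2: 40, ℓ=4: 40, ℓ=6: 40 ; others `N = 32`). [folklore] -/
theorem cells_boxE :
    BoxCellsN slL11.toFinset (fun p => (wtboxE p : ℝ)) (1 / 8) 2 1 (11 / 20) (7 / 10) 32 := by
  refine ⟨?_, ?_, ?_, ?_, ?_⟩
  · intro Δ h1 h2
    refine ⟨48, by norm_num, ?_⟩
    exact cell_nonneg_of_bernAuto_trunc wtboxE slL11_nodup slL11_deg 0 47 281 (q := 40) (a := 11)
        (L := 3) (by norm_num) (by norm_num) (by norm_num) (by rw [phatboxEs0_eq]; exact cellChk_boxE_s0l0)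
        (by norm_num; linarith) (by norm_num; linarith)
  · intro Δ h1 h2
    replace h2 := h2.le
    refine ⟨48, by norm_num, ?_⟩
    rcases le_or_gt Δ ((23 : ℝ) / 4) with hd0 | hd0
    · exact cell_nonneg_of_bernAuto_trunc wtboxE slL11_nodup slL11_deg 0 47 281 (q := 8) (a := 8)
        (L := 15) (by norm_num) (by norm_num) (by norm_num) (by rw [phatboxEs0_eq]; exact cellChk_boxE_s0l1)
        (by norm_num; linarith) (by norm_num; linarith)
    rcases le_or_gt Δ ((199 : ℝ) / 32) with hd1 | hd1
    · exact cell_nonneg_of_bernAuto_trunc wtboxE slL11_nodup slL11_deg 0 47 281 (q := 64) (a := 184)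
        (L := 15) (by norm_num) (by norm_num) (by norm_num) (by rw [phatboxEs0_eq]; exact cellChk_boxE_s0l2)
        (by norm_num; linarith) (by norm_num; linarith)
    rcases le_or_gt Δ ((107 : ℝ) / 16) with hd2 | hd2
    · exact cell_nonneg_of_bernAuto_trunc wtboxE slL11_nodup slL11_deg 0 47 281 (q := 64) (a := 199)
        (L := 15) (by norm_num) (by norm_num) (by norm_num) (by rw [phatboxEs0_eq]; exact cellChk_boxE_s0l3)
        (by norm_num; linarith) (by norm_num; linarith)
    rcases le_or_gt Δ ((61 : ℝ) / 8) with hd3 | hd3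
    · exact cell_nonneg_of_bernAuto_trunc wtboxE slL11_nodup slL11_deg 0 47 281 (q := 32) (a := 107)
        (L := 15) (by norm_num) (by norm_num) (by norm_num) (by rw [phatboxEs0_eq]; exact cellChk_boxE_s0l4)
        (by norm_num; linarith) (by norm_num; linarith)
    rcases le_or_gt Δ ((19 : ℝ) / 2) with hd4 | hd4
    · exact cell_nonneg_of_bernAuto_trunc wtboxE slL11_nodup slL11_deg 0 47 281 (q := 16) (a := 61)
        (L := 15) (by norm_num) (by norm_num) (by norm_num) (by rw [phatboxEs0_eq]; exact cellChk_boxE_s0l5)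
        (by norm_num; linarith) (by norm_num; linarith)
    rcases le_or_gt Δ (17 : ℝ) with hd5 | hd5
    · exact cell_nonneg_of_bernAuto_trunc wtboxE slL11_nodup slL11_deg 0 47 281 (q := 4) (a := 19)
        (L := 15) (by norm_num) (by norm_num) (by norm_num) (by rw [phatboxEs0_eq]; exact cellChk_boxE_s0l6)
        (by norm_num; linarith) (by norm_num; linarith)
    exact cell_nonneg_of_bernAuto_trunc wtboxE slL11_nodup slL11_deg 0 47 281 (q := 2) (a := 17)
        (L := 15) (by norm_num) (by norm_num) (by norm_num) (by rw [phatboxEs0_eq]; exact cellChk_boxE_s0l7)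
        (by norm_num; linarith) (by norm_num; linarith)
  · refine ⟨40, by norm_num, ?_⟩
    exact cell_nonneg_of_bernAuto_trunc wtboxE slL11_nodup slL11_deg 2 39 230 (q := 1) (a := 0)
        (L := 0) (by norm_num) (by norm_num) (by norm_num) (by rw [phatboxEs2_eq]; exact cellChk_boxE_s2l0)
        (by norm_num) (by norm_num)
  · intro Δ h1 h2
    replace h1 : (3 : ℝ) ≤ Δ := by linarith
    replace h2 := h2.le
    refine ⟨40, by norm_num, ?_⟩
    rcases le_or_gt Δ ((77 : ℝ) / 16) with hd0 | hd0
    · exact cell_nonneg_of_bernAuto_trunc wtboxE slL11_nodup slL11_deg 2 39 230 (q := 32) (a := 16)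
        (L := 29) (by norm_num) (by norm_num) (by norm_num) (by rw [phatboxEs2_eq]; exact cellChk_boxE_s2l1)
        (by norm_num; linarith) (by norm_num; linarith)
    rcases le_or_gt Δ ((183 : ℝ) / 32) with hd1 | hd1
    · exact cell_nonneg_of_bernAuto_trunc wtboxE slL11_nodup slL11_deg 2 39 230 (q := 64) (a := 90)
        (L := 29) (by norm_num) (by norm_num) (by norm_num) (by rw [phatboxEs2_eq]; exact cellChk_boxE_s2l2)
        (by norm_num; linarith) (by norm_num; linarith)
    rcases le_or_gt Δ ((395 : ℝ) / 64) with hd2 | hd2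
    · exact cell_nonneg_of_bernAuto_trunc wtboxE slL11_nodup slL11_deg 2 39 230 (q := 128) (a := 238)
        (L := 29) (by norm_num) (by norm_num) (by norm_num) (by rw [phatboxEs2_eq]; exact cellChk_boxE_s2l3)
        (by norm_num; linarith) (by norm_num; linarith)
    rcases le_or_gt Δ ((819 : ℝ) / 128) with hd3 | hd3
    · exact cell_nonneg_of_bernAuto_trunc wtboxE slL11_nodup slL11_deg 2 39 230 (q := 256) (a := 534)
        (L := 29) (by norm_num) (by norm_num) (by norm_num) (by rw [phatboxEs2_eq]; exact cellChk_boxE_s2l4)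
        (by norm_num; linarith) (by norm_num; linarith)
    rcases le_or_gt Δ ((53 : ℝ) / 8) with hd4 | hd4
    · exact cell_nonneg_of_bernAuto_trunc wtboxE slL11_nodup slL11_deg 2 39 230 (q := 256) (a := 563)
        (L := 29) (by norm_num) (by norm_num) (by norm_num) (by rw [phatboxEs2_eq]; exact cellChk_boxE_s2l5)
        (by norm_num; linarith) (by norm_num; linarith)
    rcases le_or_gt Δ ((41 : ℝ) / 4) with hd5 | hd5
    · exact cell_nonneg_of_bernAuto_trunc wtboxE slL11_nodup slL11_deg 2 39 230 (q := 16) (a := 37)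
        (L := 29) (by norm_num) (by norm_num) (by norm_num) (by rw [phatboxEs2_eq]; exact cellChk_boxE_s2l6)
        (by norm_num; linarith) (by norm_num; linarith)
    rcases le_or_gt Δ ((35 : ℝ) / 2) with hd6 | hd6
    · exact cell_nonneg_of_bernAuto_trunc wtboxE slL11_nodup slL11_deg 2 39 230 (q := 8) (a := 33)
        (L := 29) (by norm_num) (by norm_num) (by norm_num) (by rw [phatboxEs2_eq]; exact cellChk_boxE_s2l7)
        (by norm_num; linarith) (by norm_num; linarith)
    exact cell_nonneg_of_bernAuto_trunc wtboxE slL11_nodup slL11_deg 2 39 230 (q := 4) (a := 31)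
        (L := 29) (by norm_num) (by norm_num) (by norm_num) (by rw [phatboxEs2_eq]; exact cellChk_boxE_s2l8)
        (by norm_num; linarith) (by norm_num; linarith)
  · intro ℓ hℓ hℓ0 hℓ2 Δ hℓΔ hΔ
    have hℓR : (ℓ : ℝ) < 32 := lt_of_le_of_lt hℓΔ hΔ
    have hℓ32 : ℓ < 32 := by exact_mod_cast hℓR
    replace h2 := hΔ.le
    interval_cases ℓ
    · exact absurd rfl hℓ0
    · exact absurd hℓ (by decide)
    · exact absurd rfl hℓ2
    · exact absurd hℓ (by decide)
    · have h1 : (4 : ℝ) ≤ Δ := by exact_mod_cast hℓΔ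
      refine ⟨40, by norm_num, ?_⟩
      rcases le_or_gt Δ ((23 : ℝ) / 4) with hd0 | hd0
      · exact cell_nonneg_of_bernAuto_trunc wtboxE slL11_nodup slL11_deg 4 39 233 (q := 8) (a := 0)
          (L := 7) (by norm_num) (by norm_num) (by norm_num) (by rw [phatboxEs4_eq]; exact cellChk_boxE_s4l0)
          (by norm_num; linarith) (by norm_num; linarith)
      rcases le_or_gt Δ ((15 : ℝ) / 2) with hd1 | hd1
      · exact cell_nonneg_of_bernAuto_trunc wtboxE slL11_nodup slL11_deg 4 39 233 (q := 8) (a := 7)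
          (L := 7) (by norm_num) (by norm_num) (by norm_num) (by rw [phatboxEs4_eq]; exact cellChk_boxE_s4l1)
          (by norm_num; linarith) (by norm_num; linarith)
      rcases le_or_gt Δ (11 : ℝ) with hd2 | hd2
      · exact cell_nonneg_of_bernAuto_trunc wtboxE slL11_nodup slL11_deg 4 39 233 (q := 4) (a := 7)
          (L := 7) (by norm_num) (by norm_num) (by norm_num) (by rw [phatboxEs4_eq]; exact cellChk_boxE_s4l2)
          (by norm_num; linarith) (by norm_num; linarith)
      rcases le_or_gt Δ (18 : ℝ) with hd3 | hd3
      · exact cell_nonneg_of_bernAuto_trunc wtboxE slL11_nodup slL11_deg 4 39 233 (q := 2) (a := 7)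
          (L := 7) (by norm_num) (by norm_num) (by norm_num) (by rw [phatboxEs4_eq]; exact cellChk_boxE_s4l3)
          (by norm_num; linarith) (by norm_num; linarith)
      exact cell_nonneg_of_bernAuto_trunc wtboxE slL11_nodup slL11_deg 4 39 233 (q := 1) (a := 7)
          (L := 7) (by norm_num) (by norm_num) (by norm_num) (by rw [phatboxEs4_eq]; exact cellChk_boxE_s4l4)
          (by norm_num; linarith) (by norm_num; linarith)
    · exact absurd hℓ (by decide)
    · have h1 : (6 : ℝ) ≤ Δ := by exact_mod_cast hℓΔ
      refine ⟨40, by norm_num, ?_⟩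
      rcases le_or_gt Δ ((37 : ℝ) / 4) with hd0 | hd0
      · exact cell_nonneg_of_bernAuto_trunc wtboxE slL11_nodup slL11_deg 6 39 237 (q := 8) (a := 0)
          (L := 13) (by norm_num) (by norm_num) (by norm_num) (by rw [phatboxEs6_eq]; exact cellChk_boxE_s6l0)
          (by norm_num; linarith) (by norm_num; linarith)
      rcases le_or_gt Δ ((25 : ℝ) / 2) with hd1 | hd1
      · exact cell_nonneg_of_bernAuto_trunc wtboxE slL11_nodup slL11_deg 6 39 237 (q := 8) (a := 13)
          (L := 13) (by norm_num) (by norm_num) (by norm_num) (by rw [phatboxEs6_eq]; exact cellChk_boxE_s6l1)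
          (by norm_num; linarith) (by norm_num; linarith)
      rcases le_or_gt Δ (19 : ℝ) with hd2 | hd2
      · exact cell_nonneg_of_bernAuto_trunc wtboxE slL11_nodup slL11_deg 6 39 237 (q := 4) (a := 13)
          (L := 13) (by norm_num) (by norm_num) (by norm_num) (by rw [phatboxEs6_eq]; exact cellChk_boxE_s6l2)
          (by norm_num; linarith) (by norm_num; linarith)
      exact cell_nonneg_of_bernAuto_trunc wtboxE slL11_nodup slL11_deg 6 39 237 (q := 2) (a := 13)
          (L := 13) (by norm_num) (by norm_num) (by norm_num) (by rw [phatboxEs6_eq]; exact cellChk_boxE_s6l3)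
          (by norm_num; linarith) (by norm_num; linarith)
    · exact absurd hℓ (by decide)
    · have h1 : (8 : ℝ) ≤ Δ := by exact_mod_cast hℓΔ
      refine ⟨32, by norm_num, ?_⟩
      rcases le_or_gt Δ (20 : ℝ) with hd0 | hd0
      · exact cell_nonneg_of_bernAuto_trunc wtboxE slL11_nodup slL11_deg 8 31 186 (q := 1) (a := 0)
          (L := 6) (by norm_num) (by norm_num) (by norm_num) (by rw [phatboxEs8_eq]; exact cellChk_boxE_s8l0)
          (by norm_num; linarith) (by norm_num; linarith)
      exact cell_nonneg_of_bernAuto_trunc wtboxE slL11_nodup slL11_deg 8 31 186 (q := 1) (a := 6)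
          (L := 6) (by norm_num) (by norm_num) (by norm_num) (by rw [phatboxEs8_eq]; exact cellChk_boxE_s8l1)
          (by norm_num; linarith) (by norm_num; linarith)
    · exact absurd hℓ (by decide)
    · have h1 : (10 : ℝ) ≤ Δ := by exact_mod_cast hℓΔ
      refine ⟨32, by norm_num, ?_⟩
      exact cell_nonneg_of_bernAuto_trunc wtboxE slL11_nodup slL11_deg 10 31 188 (q := 1) (a := 0)
          (L := 11) (by norm_num) (by norm_num) (by norm_num) (by rw [phatboxEs10_eq]; exact cellChk_boxE_s10l0)
          (by norm_num; linarith) (by norm_num; linarith)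
    · exact absurd hℓ (by decide)
    · have h1 : (12 : ℝ) ≤ Δ := by exact_mod_cast hℓΔ
      refine ⟨32, by norm_num, ?_⟩
      exact cell_nonneg_of_bernAuto_trunc wtboxE slL11_nodup slL11_deg 12 31 191 (q := 1) (a := 0)
          (L := 10) (by norm_num) (by norm_num) (by norm_num) (by rw [phatboxEs12_eq]; exact cellChk_boxE_s12l0)
          (by norm_num; linarith) (by norm_num; linarith)
    · exact absurd hℓ (by decide)
    · have h1 : (14 : ℝ) ≤ Δ := by exact_mod_cast hℓΔ
      refine ⟨32, by norm_num, ?_⟩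
      exact cell_nonneg_of_bernAuto_trunc wtboxE slL11_nodup slL11_deg 14 31 193 (q := 1) (a := 0)
          (L := 9) (by norm_num) (by norm_num) (by norm_num) (by rw [phatboxEs14_eq]; exact cellChk_boxE_s14l0)
          (by norm_num; linarith) (by norm_num; linarith)
    · exact absurd hℓ (by decide)
    · have h1 : (16 : ℝ) ≤ Δ := by exact_mod_cast hℓΔ
      refine ⟨32, by norm_num, ?_⟩
      exact cell_nonneg_of_bernAuto_trunc wtboxE slL11_nodup slL11_deg 16 31 195 (q := 1) (a := 0)
          (L := 8) (by norm_num) (by norm_num) (by norm_num) (by rw [phatboxEs16_eq]; exact cellChk_boxE_s16l0)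
          (by norm_num; linarith) (by norm_num; linarith)
    · exact absurd hℓ (by decide)
    · have h1 : (18 : ℝ) ≤ Δ := by exact_mod_cast hℓΔ
      refine ⟨32, by norm_num, ?_⟩
      exact cell_nonneg_of_bernAuto_trunc wtboxE slL11_nodup slL11_deg 18 31 197 (q := 1) (a := 0)
          (L := 7) (by norm_num) (by norm_num) (by norm_num) (by rw [phatboxEs18_eq]; exact cellChk_boxE_s18l0)
          (by norm_num; linarith) (by norm_num; linarith)
    · exact absurd hℓ (by decide)
    · have h1 : (20 : ℝ) ≤ Δ := by exact_mod_cast hℓΔ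
      refine ⟨32, by norm_num, ?_⟩
      exact cell_nonneg_of_bernAuto_trunc wtboxE slL11_nodup slL11_deg 20 31 199 (q := 1) (a := 0)
          (L := 6) (by norm_num) (by norm_num) (by norm_num) (by rw [phatboxEs20_eq]; exact cellChk_boxE_s20l0)
          (by norm_num; linarith) (by norm_num; linarith)
    · exact absurd hℓ (by decide)
    · have h1 : (22 : ℝ) ≤ Δ := by exact_mod_cast hℓΔ
      refine ⟨32, by norm_num, ?_⟩
      exact cell_nonneg_of_bernAuto_trunc wtboxE slL11_nodup slL11_deg 22 31 200 (q := 1) (a := 0)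
          (L := 5) (by norm_num) (by norm_num) (by norm_num) (by rw [phatboxEs22_eq]; exact cellChk_boxE_s22l0)
          (by norm_num; linarith) (by norm_num; linarith)
    · exact absurd hℓ (by decide)
    · have h1 : (24 : ℝ) ≤ Δ := by exact_mod_cast hℓΔ
      refine ⟨32, by norm_num, ?_⟩
      exact cell_nonneg_of_bernAuto_trunc wtboxE slL11_nodup slL11_deg 24 31 202 (q := 1) (a := 0)
          (L := 4) (by norm_num) (by norm_num) (by norm_num) (by rw [phatboxEs24_eq]; exact cellChk_boxE_s24l0)
          (by norm_num; linarith) (by norm_num; linarith)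
    · exact absurd hℓ (by decide)
    · have h1 : (26 : ℝ) ≤ Δ := by exact_mod_cast hℓΔ
      refine ⟨32, by norm_num, ?_⟩
      exact cell_nonneg_of_bernAuto_trunc wtboxE slL11_nodup slL11_deg 26 31 203 (q := 1) (a := 0)
          (L := 3) (by norm_num) (by norm_num) (by norm_num) (by rw [phatboxEs26_eq]; exact cellChk_boxE_s26l0)
          (by norm_num; linarith) (by norm_num; linarith)
    · exact absurd hℓ (by decide)
    · have h1 : (28 : ℝ) ≤ Δ := by exact_mod_cast hℓΔ
      refine ⟨32, by norm_num, ?_⟩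
      exact cell_nonneg_of_bernAuto_trunc wtboxE slL11_nodup slL11_deg 28 31 205 (q := 1) (a := 0)
          (L := 2) (by norm_num) (by norm_num) (by norm_num) (by rw [phatboxEs28_eq]; exact cellChk_boxE_s28l0)
          (by norm_num; linarith) (by norm_num; linarith)
    · exact absurd hℓ (by decide)
    · have h1 : (30 : ℝ) ≤ Δ := by exact_mod_cast hℓΔ
      refine ⟨32, by norm_num, ?_⟩
      exact cell_nonneg_of_bernAuto_trunc wtboxE slL11_nodup slL11_deg 30 31 206 (q := 1) (a := 0)
          (L := 1) (by norm_num) (by norm_num) (by norm_num) (by rw [phatboxEs30_eq]; exact cellChk_boxE_s30l0)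
          (by norm_num; linarith) (by norm_num; linarith)
    · exact absurd hℓ (by decide)

end Summit.CriticalPhenomena.Ising3D.Control2D
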